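/-
Copyright (c) 2026 the pub-hodgecm-mathlib formalisation cell (harness21).  Prover seat hodgecm-mathlib-R90-C133-p02 (g2), Track B ∕ R90-TF, h413 = `stmt-HodgeConjecture-24833`,
R90-TF section S8 «ContSpec-n½» (S8 dealer R90-CS-plan (g3) S8-R213 (a) «(T_f) GO HYPOTHESIS-FIRST», payer name of record `R90S8ResGMidAtomTransFiniteOfExportsU3`; census
`R90/S8/CENSUS-hTRANS-payer.R90-C133-p02-g2.md` 8d98775fd52c510b): THE COMPOSITION — the finite-adelic half (T_f) of the invariance letter `hTRANSτ` of ★ p864333 is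
★ FILE A (re-expansion, `R90S8ResGMidAtomFlatReexpansionU3`) ∘ ★ FILE B (residue classes along a re-expansion, p864395) modulo ONE interim letter `hEXI` (the middle-pole
continuation data of every continuous `K_∞`-finite τ-level pair-section = ESTATE T's exports in ★ D1's clause shape); plus the junction `G(𝔸) = ι(G_∞)·ι_f(G(𝔸_f))` turning
{(T_f), (T_∞)} into `hTRANSτ`, and the `hDISC` of record from {`hW1`, `hEXI`, (T_∞)}.
-/
import Summits.HodgeConjecture.HodgeConjecture.Theorems.R90S8ResGMidAtomFlatReexpansionU3   -- ★ FILE A (this seat): pieces `ψ_r`, their laws, the re-expansion; brings ★ p864395 FILE B, ★ p864333 τ-record, ★ τ-DEFS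
import HarnessLib

/-!
# S8 (R)′ road, letter `hTRANSτ` — `R90S8ResGMidAtomTransFiniteOfExportsU3`: (T_f) FROM THE EXPORTS OF THE PIECES; `hTRANSτ` FROM {(T_f), (T_∞)}; `hDISC` FROM {`hW1`, `hEXI`, (T_∞)}

Track B ∕ R90-TF, crux h413 = `stmt-HodgeConjecture-24833`, route of record `HCCMUnconditional`; cell `hodgecm-mathlib`, R90-TF section S8 «ContSpec-n½ ∕ ResidualSpectrum», socket (R)
(B ED. 7 :337) ← ★ `res_midBlock_le_residual_of_letters' (hDISC) …` ← ★ p864333 `hDISC_of_tauRecord (hW1) (hTRANSτ)` ← THIS FILE `hTRANSτ_of_fin_of_arch (hfin) (harch)` with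
`hfin` := ★ `rightRegular_finAdelic_apply_mem_span_of_exports (hEXI)` (THIS FILE) and `harch` = (T_∞) [ARCH-INV, L].  THEOREMS ONLY (no `def`, no `instance`, no `notation`, no
named-fact hypothesis, no `sorry`; default heartbeats); lane `--supports stmt-HodgeConjecture-24833 --as helper` (count-neutral).  CLOSES NO SOCKET.

THE INTERIM LETTER `hEXI` (hypothesis-first, S8-R213 (a)): for every τ-level `U₁` and every continuous `K_∞`-finite `ψ ∈ V(χ₁, χ₂; ι_f(U₁), 1)` (`χ₁ = ξ.bcη⁻¹·ξ.bcψ⁻¹·μω`, `χ₂ = ξ.ψ`),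
★ D1's continuation clause list holds for SOME data: `Ec` continuing `z ↦ E(flat(ψ, z))` to `{1 < Re}` off finitely many real points of `(1, 2]`, a pole letter `Fp` analytic at `3∕2`
with `Fp = (z − 3∕2)·Ec` near `3∕2`, and an `L²` class `f` a.e. equal to `x ↦ Fp((out x)⁻¹)(3∕2)` — the exports of ESTATE T (K-finite `χ`-Eisenstein series: continuation, at most
simple real poles in `(1, 2]`, square-integrable residues [MW95 IV.1.11, V.3.13]) read in D1's shape; an adapter of ≤ 10 lines binds it to ESTATE T's head when that lands.
THE MATHEMATICS ([MoeglinWaldspurger1995] II.1.5, IV.1.11, V.3.13; [BorelJacquet1979] §4.1).  (T_f): a τ-admissible generator `f` at `U₀` has a section `φ` with data; by ★ FILE A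
`r(ι_f g)` re-expands `flat(φ, z)` along the pieces `ψ_r` (`r` over the exact value set of the height cocycle, all `> 0`), each `ψ_r` a continuous `K_∞`-finite pair-section at the
τ-level `U₀ ∩ gU₀g⁻¹`; `hEXI` supplies their data `(Ec_r, Sp_r, Fp_r, f_r)`, which makes each `f_r` a τ-admissible generator at `U₀ ∩ gU₀g⁻¹`; ★ FILE B concludes
`R(ι_f g) f = Σ_r r^{3/2} f_r ∈ span G_τ`.  JUNCTION: `g = ι(g_∞)·ι_f(g_f)` (★ `archToAdelic_mul_finAdelicToAdelic`), `R(g) = R(ι g_∞) ∘ R(ι_f g_f)`, and (T_∞) on generators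
extends to their span by linearity and closedness of the target.
* §1 **`rightRegular_finAdelic_apply_mem_span_of_exports (hμu) (hEXI)`** — (T_f): `R(ι_f g) f ∈ span G_τ` for every τ-admissible generator `f` and every `g ∈ G(𝔸_f)`.
* §2 **`hTRANSτ_of_fin_of_arch (hfin) (harch)`** — the junction; **`hTRANSτ_of_exports_of_arch (hμu) (hEXI) (harch)`**.
* §3 **`hDISC_of_exports_of_arch (hW1) (hEXI) (hARCH)`** — `hDISC` of record (conclusion bytes of ★ p864333 VERBATIM) from the three named letters, ∀-closed in the frame.
HONEST LABEL: HC_CM is proved only modulo the 7 printed citations (2 remaining named inputs: hLiu418 = `stmt-HodgeConjecture-24832`, h413 = `stmt-HodgeConjecture-24833`) until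
rung 0 closes; REL ≠ ★ ≠ BUILT; THE LEDGER after this file: `hDISC` = ★ ∘ {`hW1` (K2E1-p10, density of K-finite residues), `hEXI` (ESTATE T exports in D1 shape), `hARCH` = (T_∞)
(archimedean translates of τ-admissible residues; analytic vectors ∕ `U(𝔤)`, L)}; pays no socket by itself; count-neutral.

## References
* [MoeglinWaldspurger1995] C. Mœglin, J.-L. Waldspurger, *Spectral Decomposition and Eisenstein Series* (1995), I.2.17, II.1.5, IV.1.11, V.3.13.
* [BorelJacquet1979] A. Borel, H. Jacquet, *Automorphic forms and automorphic representations*, Proc. Symp. Pure Math. 33.1 (1979), §4.1, §4.6.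
-/

set_option autoImplicit false
set_option linter.dupNamespace false  -- the mandated namespace `…HodgeConjecture.HodgeConjecture.R90.S8` (LEAD #1 L1) repeats the summit's segment

noncomputable section

open MeasureTheory Measure Set Filter Topology NumberField ContRepresentation
open Literature.NumberTheory Literature.NumberTheory.Automorphic Literature.NumberTheory.Automorphic.UnitaryGroup Literature.NumberTheory.GaloisRepresentations AdelicGroupData
open Literature.NumberTheory.Automorphic.Arthur2013.Leaves.TECR Literature.NumberTheory.Rogawski1990
open Summit.HodgeConjecture.HodgeConjecture.Cruxes.H413.K2E1BorelEisensteinU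
open Summit.HodgeConjecture.HodgeConjecture.Cruxes.H413.K2E1CharacterEisensteinU3PairDefs
open Summit.HodgeConjecture.HodgeConjecture.Cruxes.H413.K2E1ChiSectionSpaceU3PairDefs
open scoped ENNReal NNReal

namespace Summit.HodgeConjecture.HodgeConjecture.R90.S8

section Main

variable (L : Type) [Field L] [NumberField L] [IsCMField L]
  (μ : Measure (quasiSplit (↥(maximalRealSubfield L)) L (IsCMField.complexConj L) 3).automorphicQuotient) [(quasiSplit (↥(maximalRealSubfield L)) L (IsCMField.complexConj L) 3).IsAutomorphicMeasure μ] (ξ : OneDimAutRepH L) (μω : HeckeCharacter L)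

/-! ## §1 (T_f): finite-adelic translates of τ-admissible generators lie in `span G_τ`, modulo the exports of the pieces -/

/-- **(T_f) FROM THE EXPORTS OF THE PIECES**: for `μω` unitary and the interim letter `hEXI` (★ D1's continuation data for every continuous `K_∞`-finite τ-level pair-section), every
finite-adelic right translate `R(ι_f g) f` of a τ-admissible generator `f` at a τ-level `U₀` lies in the algebraic span of the τ-admissible generators: ★ FILE A's pieces `ψ_r` at the
τ-level `U₀ ∩ gU₀g⁻¹` (★ `isTauLevel_inf_comap_conj`) with their laws, `hEXI`'s data for each, and ★ FILE B `rightRegular_apply_mem_span_tauGenerators_of_flatReexpansion` on ★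
`flatSectionU_mul_finAdelicToAdelic_eq_sum`. [cite: MoeglinWaldspurger1995, II.1.5, IV.1.11, V.3.13] [cite: BorelJacquet1979, §4.1] -/
theorem rightRegular_finAdelic_apply_mem_span_of_exports (hμu : μω.IsUnitary)
    (hEXI : ∀ (U₁ : Subgroup ↥(finAdelic (↥(maximalRealSubfield L)) L (IsCMField.complexConj L) 3 ((StdForm.antidiagonal 3).over L))), IsTauLevel L U₁ → ∀ (ψ : (quasiSplit (↥(maximalRealSubfield L)) L (IsCMField.complexConj L) 3).Adelic → ℂ),
      ψ ∈ chiSectionSpacePair (ξ.bcη⁻¹ * ξ.bcψ⁻¹ * μω) ξ.ψ (tauLevel L U₁) ((1 : ↥(tauLevel L U₁) →* ℂ) : ↥(tauLevel L U₁) → ℂ) → Continuous ψ → IsArchFinite L ψ →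
      ∃ (Ec : ℂ → (quasiSplit (↥(maximalRealSubfield L)) L (IsCMField.complexConj L) 3).Adelic → ℂ) (Sp : Finset ℂ) (_ : ∀ s ∈ Sp, s.im = 0 ∧ 1 < s.re ∧ s.re ≤ 2)
        (_ : ∀ g, DifferentiableOn ℂ (fun z => Ec z g) ({z : ℂ | 1 < z.re} \ (↑Sp : Set ℂ))) (_ : ∀ z : ℂ, 2 < z.re → Ec z = eisensteinSeriesU (flatSectionU ψ z))
        (Fp : (quasiSplit (↥(maximalRealSubfield L)) L (IsCMField.complexConj L) 3).Adelic → ℂ → ℂ) (_ : ∀ g, AnalyticAt ℂ (Fp g) ((3 : ℂ) / 2)) (_ : ∀ g, Fp g =ᶠ[𝓝[≠] ((3 : ℂ) / 2)] fun z => (z - (3 : ℂ) / 2) * Ec z g)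
        (f : (quasiSplit (↥(maximalRealSubfield L)) L (IsCMField.complexConj L) 3).L2 μ), (f : (quasiSplit (↥(maximalRealSubfield L)) L (IsCMField.complexConj L) 3).automorphicQuotient → ℂ) =ᵐ[μ] fun x => Fp (Quotient.out (x : (quasiSplit (↥(maximalRealSubfield L)) L (IsCMField.complexConj L) 3).Adelic ⧸ (quasiSplit (↥(maximalRealSubfield L)) L (IsCMField.complexConj L) 3).quotientSubgroup))⁻¹ ((3 : ℂ) / 2))
    {U₀ : Subgroup ↥(finAdelic (↥(maximalRealSubfield L)) L (IsCMField.complexConj L) 3 ((StdForm.antidiagonal 3).over L))} (hU₀ : IsTauLevel L U₀) {f : (quasiSplit (↥(maximalRealSubfield L)) L (IsCMField.complexConj L) 3).L2 μ} (hf : f ∈ resGMidAtomGenτ L μ ξ μω U₀) (g : ↥(finAdelic (↥(maximalRealSubfield L)) L (IsCMField.complexConj L) 3 ((StdForm.antidiagonal 3).over L))) :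
    ((quasiSplit (↥(maximalRealSubfield L)) L (IsCMField.complexConj L) 3).rightRegular μ) (finAdelicToAdelic (↥(maximalRealSubfield L)) L (IsCMField.complexConj L) 3 ((StdForm.antidiagonal 3).over L) g) f ∈ Submodule.span ℂ (⋃ (U₀ : Subgroup ↥(finAdelic (↥(maximalRealSubfield L)) L (IsCMField.complexConj L) 3 ((StdForm.antidiagonal 3).over L))) (_ : IsTauLevel L U₀), resGMidAtomGenτ L μ ξ μω U₀) := by
  classical
  obtain ⟨φ, hφ, hφc, hφa, Ec, Sp, hSp, hol, hEc, Fp, hF, hFE, hae⟩ := hf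
  obtain ⟨s, hs, hpos⟩ := exists_finset_range_heightCocycle L g
  have hU₁ : IsTauLevel L (U₀ ⊓ U₀.comap ((MulAut.conj g).symm.toMonoidHom : ↥(finAdelic (↥(maximalRealSubfield L)) L (IsCMField.complexConj L) 3 ((StdForm.antidiagonal 3).over L)) →* ↥(finAdelic (↥(maximalRealSubfield L)) L (IsCMField.complexConj L) 3 ((StdForm.antidiagonal 3).over L)))) := isTauLevel_inf_comap_conj hU₀ g
  -- the pieces `ψ_r` and their laws (★ FILE A)
  have hψ : ∀ r : ℝ≥0, ({x : (quasiSplit (↥(maximalRealSubfield L)) L (IsCMField.complexConj L) 3).Adelic | borelHeight (x * finAdelicToAdelic (↥(maximalRealSubfield L)) L (IsCMField.complexConj L) 3 ((StdForm.antidiagonal 3).over L) g) / borelHeight x = r}.indicator fun y => φ (y * finAdelicToAdelic (↥(maximalRealSubfield L)) L (IsCMField.complexConj L) 3 ((StdForm.antidiagonal 3).over L) g)) ∈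
      chiSectionSpacePair (ξ.bcη⁻¹ * ξ.bcψ⁻¹ * μω) ξ.ψ (tauLevel L (U₀ ⊓ U₀.comap ((MulAut.conj g).symm.toMonoidHom : ↥(finAdelic (↥(maximalRealSubfield L)) L (IsCMField.complexConj L) 3 ((StdForm.antidiagonal 3).over L)) →* ↥(finAdelic (↥(maximalRealSubfield L)) L (IsCMField.complexConj L) 3 ((StdForm.antidiagonal 3).over L))))) ((1 : ↥(tauLevel L (U₀ ⊓ U₀.comap ((MulAut.conj g).symm.toMonoidHom : ↥(finAdelic (↥(maximalRealSubfield L)) L (IsCMField.complexConj L) 3 ((StdForm.antidiagonal 3).over L)) →* ↥(finAdelic (↥(maximalRealSubfield L)) L (IsCMField.complexConj L) 3 ((StdForm.antidiagonal 3).over L))))) →* ℂ) : ↥(tauLevel L (U₀ ⊓ U₀.comap ((MulAut.conj g).symm.toMonoidHom : ↥(finAdelic (↥(maximalRealSubfield L)) L (IsCMField.complexConj L) 3 ((StdForm.antidiagonal 3).over L)) →* ↥(finAdelic (↥(maximalRealSubfield L)) L (IsCMField.complexConj L) 3 ((StdForm.antidiagonal 3).over L))))) → ℂ) :=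
    fun r => indicator_translate_mem_chiSectionSpacePair hU₀ g r hφ
  have hψc : ∀ r : ℝ≥0, Continuous ({x : (quasiSplit (↥(maximalRealSubfield L)) L (IsCMField.complexConj L) 3).Adelic | borelHeight (x * finAdelicToAdelic (↥(maximalRealSubfield L)) L (IsCMField.complexConj L) 3 ((StdForm.antidiagonal 3).over L) g) / borelHeight x = r}.indicator fun y => φ (y * finAdelicToAdelic (↥(maximalRealSubfield L)) L (IsCMField.complexConj L) 3 ((StdForm.antidiagonal 3).over L) g)) := fun r => continuous_indicator_translate L g r hφc
  have hψa : ∀ r : ℝ≥0, IsArchFinite L ({x : (quasiSplit (↥(maximalRealSubfield L)) L (IsCMField.complexConj L) 3).Adelic | borelHeight (x * finAdelicToAdelic (↥(maximalRealSubfield L)) L (IsCMField.complexConj L) 3 ((StdForm.antidiagonal 3).over L) g) / borelHeight x = r}.indicator fun y => φ (y * finAdelicToAdelic (↥(maximalRealSubfield L)) L (IsCMField.complexConj L) 3 ((StdForm.antidiagonal 3).over L) g)) := fun r => isArchFinite_indicator_translate L g r hφa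
  -- their exports
  choose Ecι Spι hSpι holι hEcι Fpι hFι hFEι fι haeι using fun r : ℝ≥0 => hEXI _ hU₁ _ (hψ r) (hψc r) (hψa r)
  exact rightRegular_apply_mem_span_tauGenerators_of_flatReexpansion L μ ξ μω hμu (chiSectionSpacePair_le_bot L _ 1 hφ) Ec Sp hSp hol hEc Fp hF hFE hae (finAdelicToAdelic (↥(maximalRealSubfield L)) L (IsCMField.complexConj L) 3 ((StdForm.antidiagonal 3).over L) g) s (fun r => r) hpos
    (fun r => ({x : (quasiSplit (↥(maximalRealSubfield L)) L (IsCMField.complexConj L) 3).Adelic | borelHeight (x * finAdelicToAdelic (↥(maximalRealSubfield L)) L (IsCMField.complexConj L) 3 ((StdForm.antidiagonal 3).over L) g) / borelHeight x = r}.indicator fun y => φ (y * finAdelicToAdelic (↥(maximalRealSubfield L)) L (IsCMField.complexConj L) 3 ((StdForm.antidiagonal 3).over L) g))) (fun r _ => chiSectionSpacePair_le_bot L _ 1 (hψ r)) (fun r _ => hψc r)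
    Ecι Spι (fun r _ => hSpι r) (fun r _ => holι r) (fun r _ => hEcι r) Fpι (fun r _ => hFι r) (fun r _ => hFEι r) fι (fun r _ => haeι r)
    (fun z x => flatSectionU_mul_finAdelicToAdelic_eq_sum L g hs φ z x) (fun _ => (U₀ ⊓ U₀.comap ((MulAut.conj g).symm.toMonoidHom : ↥(finAdelic (↥(maximalRealSubfield L)) L (IsCMField.complexConj L) 3 ((StdForm.antidiagonal 3).over L)) →* ↥(finAdelic (↥(maximalRealSubfield L)) L (IsCMField.complexConj L) 3 ((StdForm.antidiagonal 3).over L))))) (fun _ _ => hU₁)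
    (fun r _ => ⟨({x : (quasiSplit (↥(maximalRealSubfield L)) L (IsCMField.complexConj L) 3).Adelic | borelHeight (x * finAdelicToAdelic (↥(maximalRealSubfield L)) L (IsCMField.complexConj L) 3 ((StdForm.antidiagonal 3).over L) g) / borelHeight x = r}.indicator fun y => φ (y * finAdelicToAdelic (↥(maximalRealSubfield L)) L (IsCMField.complexConj L) 3 ((StdForm.antidiagonal 3).over L) g)), hψ r, hψc r, hψa r, Ecι r, Spι r, hSpι r, holι r, hEcι r, Fpι r, hFι r, hFEι r, haeι r⟩)

/-! ## §2 The junction `G(𝔸) = ι(G_∞)·ι_f(G(𝔸_f))`: `hTRANSτ` from {(T_f), (T_∞)} -/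

/-- **`hTRANSτ` FROM ITS FINITE-ADELIC AND ARCHIMEDEAN HALVES**: if the finite-adelic translates of the τ-admissible generators lie in `span G_τ` ((T_f)) and the archimedean translates
lie in its closure ((T_∞)), then EVERY translate `R(g) f`, `f ∈ G_τ`, lies in the closure — `g = ι(g_∞)·ι_f(g_f)` (★ `archToAdelic_mul_finAdelicToAdelic`), `R` is multiplicative,
and (T_∞) passes from generators to their span (linearity; the closure is a submodule). [cite: BorelJacquet1979, §4.1, §4.6] [cite: MoeglinWaldspurger1995, II.1, V.3.13] -/
theorem hTRANSτ_of_fin_of_arch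
    (hfin : ∀ (U₀ : Subgroup ↥(finAdelic (↥(maximalRealSubfield L)) L (IsCMField.complexConj L) 3 ((StdForm.antidiagonal 3).over L))), IsTauLevel L U₀ → ∀ f ∈ resGMidAtomGenτ L μ ξ μω U₀, ∀ b : ↥(finAdelic (↥(maximalRealSubfield L)) L (IsCMField.complexConj L) 3 ((StdForm.antidiagonal 3).over L)),
      ((quasiSplit (↥(maximalRealSubfield L)) L (IsCMField.complexConj L) 3).rightRegular μ) (finAdelicToAdelic (↥(maximalRealSubfield L)) L (IsCMField.complexConj L) 3 ((StdForm.antidiagonal 3).over L) b) f ∈ Submodule.span ℂ (⋃ (U₀ : Subgroup ↥(finAdelic (↥(maximalRealSubfield L)) L (IsCMField.complexConj L) 3 ((StdForm.antidiagonal 3).over L))) (_ : IsTauLevel L U₀), resGMidAtomGenτ L μ ξ μω U₀))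
    (harch : ∀ (U₀ : Subgroup ↥(finAdelic (↥(maximalRealSubfield L)) L (IsCMField.complexConj L) 3 ((StdForm.antidiagonal 3).over L))), IsTauLevel L U₀ → ∀ f ∈ resGMidAtomGenτ L μ ξ μω U₀, ∀ a : ↥(arch (↥(maximalRealSubfield L)) L (IsCMField.complexConj L) 3 ((StdForm.antidiagonal 3).over L)),
      ((quasiSplit (↥(maximalRealSubfield L)) L (IsCMField.complexConj L) 3).rightRegular μ) (archToAdelic (↥(maximalRealSubfield L)) L (IsCMField.complexConj L) 3 ((StdForm.antidiagonal 3).over L) a) f ∈ (Submodule.span ℂ (⋃ (U₀ : Subgroup ↥(finAdelic (↥(maximalRealSubfield L)) L (IsCMField.complexConj L) 3 ((StdForm.antidiagonal 3).over L))) (_ : IsTauLevel L U₀), resGMidAtomGenτ L μ ξ μω U₀)).topologicalClosure) :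
    ∀ g : (quasiSplit (↥(maximalRealSubfield L)) L (IsCMField.complexConj L) 3).Adelic, ∀ f ∈ (⋃ (U₀ : Subgroup ↥(finAdelic (↥(maximalRealSubfield L)) L (IsCMField.complexConj L) 3 ((StdForm.antidiagonal 3).over L))) (_ : IsTauLevel L U₀), resGMidAtomGenτ L μ ξ μω U₀),
      ((quasiSplit (↥(maximalRealSubfield L)) L (IsCMField.complexConj L) 3).rightRegular μ) g f ∈ (Submodule.span ℂ (⋃ (U₀ : Subgroup ↥(finAdelic (↥(maximalRealSubfield L)) L (IsCMField.complexConj L) 3 ((StdForm.antidiagonal 3).over L))) (_ : IsTauLevel L U₀), resGMidAtomGenτ L μ ξ μω U₀)).topologicalClosure := by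
  intro g f hf
  obtain ⟨U₀, hU⟩ := Set.mem_iUnion.1 hf
  obtain ⟨hU₀, hfU⟩ := Set.mem_iUnion.1 hU
  -- (T_∞) on the span of the generators (linearity; the closure is a submodule)
  have hspan : Submodule.span ℂ (⋃ (U₀ : Subgroup ↥(finAdelic (↥(maximalRealSubfield L)) L (IsCMField.complexConj L) 3 ((StdForm.antidiagonal 3).over L))) (_ : IsTauLevel L U₀), resGMidAtomGenτ L μ ξ μω U₀) ≤
      ((Submodule.span ℂ (⋃ (U₀ : Subgroup ↥(finAdelic (↥(maximalRealSubfield L)) L (IsCMField.complexConj L) 3 ((StdForm.antidiagonal 3).over L))) (_ : IsTauLevel L U₀), resGMidAtomGenτ L μ ξ μω U₀)).topologicalClosure).comap ((((quasiSplit (↥(maximalRealSubfield L)) L (IsCMField.complexConj L) 3).rightRegular μ) (archToAdelic (↥(maximalRealSubfield L)) L (IsCMField.complexConj L) 3 ((StdForm.antidiagonal 3).over L) (archPart (↥(maximalRealSubfield L)) L (IsCMField.complexConj L) 3 ((StdForm.antidiagonal 3).over L) g)) : (quasiSplit (↥(maximalRealSubfield L)) L (IsCMField.complexConj L) 3).L2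 μ →L[ℂ] (quasiSplit (↥(maximalRealSubfield L)) L (IsCMField.complexConj L) 3).L2 μ) : (quasiSplit (↥(maximalRealSubfield L)) L (IsCMField.complexConj L) 3).L2 μ →ₗ[ℂ] (quasiSplit (↥(maximalRealSubfield L)) L (IsCMField.complexConj L) 3).L2 μ) := by
    refine Submodule.span_le.2 fun f' hf' => ?_
    obtain ⟨U, hU'⟩ := Set.mem_iUnion.1 hf'
    obtain ⟨hU, hfU'⟩ := Set.mem_iUnion.1 hU'
    exact harch U hU f' hfU' _
  have h1 : ((quasiSplit (↥(maximalRealSubfield L)) L (IsCMField.complexConj L) 3).rightRegular μ) (finAdelicToAdelic (↥(maximalRealSubfield L)) L (IsCMField.complexConj L) 3 ((StdForm.antidiagonal 3).over L) (finPart (↥(maximalRealSubfield L)) L (IsCMField.complexConj L) 3 ((StdForm.antidiagonal 3).over L) g)) f ∈ Submodule.span ℂ (⋃ (U₀ : Subgroup ↥(finAdelic (↥(maximalRealSubfield L)) L (IsCMField.complexConj L) 3 ((StdForm.antidiagonal 3).over L))) (_ : IsTauLevel L U₀), resGMidAtomGenτ L μ ξ μω U₀) := hfin U₀ hU₀ f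 hfU _
  have h2 := hspan h1
  rw [Submodule.mem_comap] at h2
  -- `g = ι(g_∞) · ι_f(g_f)` and `R` is multiplicative
  have hg : ((quasiSplit (↥(maximalRealSubfield L)) L (IsCMField.complexConj L) 3).rightRegular μ) g f = ((quasiSplit (↥(maximalRealSubfield L)) L (IsCMField.complexConj L) 3).rightRegular μ) (archToAdelic (↥(maximalRealSubfield L)) L (IsCMField.complexConj L) 3 ((StdForm.antidiagonal 3).over L) (archPart (↥(maximalRealSubfield L)) L (IsCMField.complexConj L) 3 ((StdForm.antidiagonal 3).over L) g)) (((quasiSplit (↥(maximalRealSubfield L)) L (IsCMField.complexConj L) 3).rightRegular μ) (finAdelicToAdelic (↥(maximalRealSubfield L)) L (IsCMField.complexConj L) 3 ((StdForm.antidiagonal 3).over L) (finPart (↥(maximalRealSubfield L)) L (IsCMField.complexConj L) 3 ((StdForm.antidiagonal 3).over L) g)) f) := by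
    conv_lhs => rw [← archToAdelic_mul_finAdelicToAdelic (↥(maximalRealSubfield L)) L (IsCMField.complexConj L) 3 ((StdForm.antidiagonal 3).over L) g]
    rw [map_mul]
    rfl
  rw [hg]
  exact h2

/-- **`hTRANSτ` FOR ONE `(L, μ, ξ, μω)` FROM {`hEXI`, (T_∞)}** (`μω` unitary): §1 ∘ §2. [cite: MoeglinWaldspurger1995, II.1.5, V.3.13] [cite: BorelJacquet1979, §4.1] -/
theorem hTRANSτ_of_exports_of_arch (hμu : μω.IsUnitary)
    (hEXI : ∀ (U₁ : Subgroup ↥(finAdelic (↥(maximalRealSubfield L)) L (IsCMField.complexConj L) 3 ((StdForm.antidiagonal 3).over L))), IsTauLevel L U₁ → ∀ (ψ : (quasiSplit (↥(maximalRealSubfield L)) L (IsCMField.complexConj L) 3).Adelic → ℂ),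
      ψ ∈ chiSectionSpacePair (ξ.bcη⁻¹ * ξ.bcψ⁻¹ * μω) ξ.ψ (tauLevel L U₁) ((1 : ↥(tauLevel L U₁) →* ℂ) : ↥(tauLevel L U₁) → ℂ) → Continuous ψ → IsArchFinite L ψ →
      ∃ (Ec : ℂ → (quasiSplit (↥(maximalRealSubfield L)) L (IsCMField.complexConj L) 3).Adelic → ℂ) (Sp : Finset ℂ) (_ : ∀ s ∈ Sp, s.im = 0 ∧ 1 < s.re ∧ s.re ≤ 2)
        (_ : ∀ g, DifferentiableOn ℂ (fun z => Ec z g) ({z : ℂ | 1 < z.re} \ (↑Sp : Set ℂ))) (_ : ∀ z : ℂ, 2 < z.re → Ec z = eisensteinSeriesU (flatSectionU ψ z))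
        (Fp : (quasiSplit (↥(maximalRealSubfield L)) L (IsCMField.complexConj L) 3).Adelic → ℂ → ℂ) (_ : ∀ g, AnalyticAt ℂ (Fp g) ((3 : ℂ) / 2)) (_ : ∀ g, Fp g =ᶠ[𝓝[≠] ((3 : ℂ) / 2)] fun z => (z - (3 : ℂ) / 2) * Ec z g)
        (f : (quasiSplit (↥(maximalRealSubfield L)) L (IsCMField.complexConj L) 3).L2 μ), (f : (quasiSplit (↥(maximalRealSubfield L)) L (IsCMField.complexConj L) 3).automorphicQuotient → ℂ) =ᵐ[μ] fun x => Fp (Quotient.out (x : (quasiSplit (↥(maximalRealSubfield L)) L (IsCMField.complexConj L) 3).Adelic ⧸ (quasiSplit (↥(maximalRealSubfield L)) L (IsCMField.complexConj L) 3).quotientSubgroup))⁻¹ ((3 : ℂ) / 2))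
    (harch : ∀ (U₀ : Subgroup ↥(finAdelic (↥(maximalRealSubfield L)) L (IsCMField.complexConj L) 3 ((StdForm.antidiagonal 3).over L))), IsTauLevel L U₀ → ∀ f ∈ resGMidAtomGenτ L μ ξ μω U₀, ∀ a : ↥(arch (↥(maximalRealSubfield L)) L (IsCMField.complexConj L) 3 ((StdForm.antidiagonal 3).over L)),
      ((quasiSplit (↥(maximalRealSubfield L)) L (IsCMField.complexConj L) 3).rightRegular μ) (archToAdelic (↥(maximalRealSubfield L)) L (IsCMField.complexConj L) 3 ((StdForm.antidiagonal 3).over L) a) f ∈ (Submodule.span ℂ (⋃ (U₀ : Subgroup ↥(finAdelic (↥(maximalRealSubfield L)) L (IsCMField.complexConj L) 3 ((StdForm.antidiagonal 3).over L))) (_ : IsTauLevel L U₀), resGMidAtomGenτ L μ ξ μω U₀)).topologicalClosure) :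
    ∀ g : (quasiSplit (↥(maximalRealSubfield L)) L (IsCMField.complexConj L) 3).Adelic, ∀ f ∈ (⋃ (U₀ : Subgroup ↥(finAdelic (↥(maximalRealSubfield L)) L (IsCMField.complexConj L) 3 ((StdForm.antidiagonal 3).over L))) (_ : IsTauLevel L U₀), resGMidAtomGenτ L μ ξ μω U₀),
      ((quasiSplit (↥(maximalRealSubfield L)) L (IsCMField.complexConj L) 3).rightRegular μ) g f ∈ (Submodule.span ℂ (⋃ (U₀ : Subgroup ↥(finAdelic (↥(maximalRealSubfield L)) L (IsCMField.complexConj L) 3 ((StdForm.antidiagonal 3).over L))) (_ : IsTauLevel L U₀), resGMidAtomGenτ L μ ξ μω U₀)).topologicalClosure :=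
  hTRANSτ_of_fin_of_arch L μ ξ μω (fun _ hU₀ _ hf b => rightRegular_finAdelic_apply_mem_span_of_exports L μ ξ μω hμu hEXI hU₀ hf b) harch

end Main

/-! ## §3 `hDISC` of record from {`hW1`, `hEXI`, `hARCH`} -/

/-- **`hDISC` OF RECORD FROM THE THREE NAMED LETTERS** — conclusion = the `hDISC` binder bytes of ★ `res_midBlock_le_residual_of_letters'` VERBATIM (as in ★ p864333); hypotheses
∀-closed in the same frame: `hW1` (K2E1-p10 (g5)'s `resGMidBlock ≤ resGMidBlockτ`, the density of the K-finite residues), `hEXI` (ESTATE T's middle-pole exports in ★ D1's clause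
shape for every continuous `K_∞`-finite τ-level pair-section), `hARCH` = (T_∞) (archimedean translates of τ-admissible residues stay in the closed span).  THE LEDGER:
`hDISC` = ★ p864333 ∘ ★ §2 ∘ {`hW1`, `hEXI`, `hARCH`}. [cite: MoeglinWaldspurger1995, I.2.17–I.2.18, II.1.5, V.3.13] [cite: Rogawski1990, §13.9 p. 229 (ii)] -/
theorem hDISC_of_exports_of_arch
    (hW1 : ∀ (L : Type) [Field L] [NumberField L] [IsCMField L]
      (μ : Measure (quasiSplit (↥(maximalRealSubfield L)) L (IsCMField.complexConj L) 3).automorphicQuotient) [(quasiSplit (↥(maximalRealSubfield L)) L (IsCMField.complexConj L) 3).IsAutomorphicMeasure μ]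
      (μω : HeckeCharacter L) (_ : μω.IsUnitary) (ξ : OneDimAutRepH L), resGMidBlock L μ ξ μω ≤ resGMidBlockτ L μ ξ μω)
    (hEXI : ∀ (L : Type) [Field L] [NumberField L] [IsCMField L]
      (μ : Measure (quasiSplit (↥(maximalRealSubfield L)) L (IsCMField.complexConj L) 3).automorphicQuotient) [(quasiSplit (↥(maximalRealSubfield L)) L (IsCMField.complexConj L) 3).IsAutomorphicMeasure μ]
      (μω : HeckeCharacter L) (_ : μω.IsUnitary) (ξ : OneDimAutRepH L), 
      ∀ (U₁ : Subgroup ↥(finAdelic (↥(maximalRealSubfield L)) L (IsCMField.complexConj L) 3 ((StdForm.antidiagonal 3).over L))), IsTauLevel L U₁ → ∀ (ψ : (quasiSplit (↥(maximalRealSubfield L)) L (IsCMField.complexConj L) 3).Adelic → ℂ),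
        ψ ∈ chiSectionSpacePair (ξ.bcη⁻¹ * ξ.bcψ⁻¹ * μω) ξ.ψ (tauLevel L U₁) ((1 : ↥(tauLevel L U₁) →* ℂ) : ↥(tauLevel L U₁) → ℂ) → Continuous ψ → IsArchFinite L ψ →
        ∃ (Ec : ℂ → (quasiSplit (↥(maximalRealSubfield L)) L (IsCMField.complexConj L) 3).Adelic → ℂ) (Sp : Finset ℂ) (_ : ∀ s ∈ Sp, s.im = 0 ∧ 1 < s.re ∧ s.re ≤ 2)
          (_ : ∀ g, DifferentiableOn ℂ (fun z => Ec z g) ({z : ℂ | 1 < z.re} \ (↑Sp : Set ℂ))) (_ : ∀ z : ℂ, 2 < z.re → Ec z = eisensteinSeriesU (flatSectionU ψ z))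
          (Fp : (quasiSplit (↥(maximalRealSubfield L)) L (IsCMField.complexConj L) 3).Adelic → ℂ → ℂ) (_ : ∀ g, AnalyticAt ℂ (Fp g) ((3 : ℂ) / 2)) (_ : ∀ g, Fp g =ᶠ[𝓝[≠] ((3 : ℂ) / 2)] fun z => (z - (3 : ℂ) / 2) * Ec z g)
          (f : (quasiSplit (↥(maximalRealSubfield L)) L (IsCMField.complexConj L) 3).L2 μ), (f : (quasiSplit (↥(maximalRealSubfield L)) L (IsCMField.complexConj L) 3).automorphicQuotient → ℂ) =ᵐ[μ] fun x => Fp (Quotient.out (x : (quasiSplit (↥(maximalRealSubfield L)) L (IsCMField.complexConj L) 3).Adelic ⧸ (quasiSplit (↥(maximalRealSubfield L)) L (IsCMField.complexConj L) 3).quotientSubgroup))⁻¹ ((3 : ℂ) / 2))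
    (hARCH : ∀ (L : Type) [Field L] [NumberField L] [IsCMField L]
      (μ : Measure (quasiSplit (↥(maximalRealSubfield L)) L (IsCMField.complexConj L) 3).automorphicQuotient) [(quasiSplit (↥(maximalRealSubfield L)) L (IsCMField.complexConj L) 3).IsAutomorphicMeasure μ]
      (μω : HeckeCharacter L) (_ : μω.IsUnitary) (ξ : OneDimAutRepH L), 
      ∀ (U₀ : Subgroup ↥(finAdelic (↥(maximalRealSubfield L)) L (IsCMField.complexConj L) 3 ((StdForm.antidiagonal 3).over L))), IsTauLevel L U₀ → ∀ f ∈ resGMidAtomGenτ L μ ξ μω U₀, ∀ a : ↥(arch (↥(maximalRealSubfield L)) L (IsCMField.complexConj L) 3 ((StdForm.antidiagonal 3).over L)),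
        ((quasiSplit (↥(maximalRealSubfield L)) L (IsCMField.complexConj L) 3).rightRegular μ) (archToAdelic (↥(maximalRealSubfield L)) L (IsCMField.complexConj L) 3 ((StdForm.antidiagonal 3).over L) a) f ∈ (Submodule.span ℂ (⋃ (U₀ : Subgroup ↥(finAdelic (↥(maximalRealSubfield L)) L (IsCMField.complexConj L) 3 ((StdForm.antidiagonal 3).over L))) (_ : IsTauLevel L U₀), resGMidAtomGenτ L μ ξ μω U₀)).topologicalClosure) :
    ∀ (L : Type) [Field L] [NumberField L] [IsCMField L]
      (μ : Measure (quasiSplit (↥(maximalRealSubfield L)) L (IsCMField.complexConj L) 3).automorphicQuotient) [(quasiSplit (↥(maximalRealSubfield L)) L (IsCMField.complexConj L) 3).IsAutomorphicMeasure μ]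
      (μω : HeckeCharacter L) (_ : μω.IsUnitary) (ξ : OneDimAutRepH L), ∀ (E : Submodule ℂ (resGMidBlock L μ ξ μω).toSubmodule)
          (hE : ∀ k, ∀ x ∈ E, ((resGMidBlock L μ ξ μω).toContRep.restrict (((standardMaximalCompactGL 3 L).comap (adelicVal (↥(maximalRealSubfield L)) L (IsCMField.complexConj L) 3 ((StdForm.antidiagonal 3).over L)) : Subgroup (quasiSplit (↥(maximalRealSubfield L)) L (IsCMField.complexConj L) 3).Adelic).subtype)) k x ∈ E), FiniteDimensional ℂ E →
          (((resGMidBlock L μ ξ μω).toContRep.restrict (((standardMaximalCompactGL 3 L).comap (adelicVal (↥(maximalRealSubfield L)) L (IsCMField.complexConj L) 3 ((StdForm.antidiagonal 3).over L)) : Subgroup (quasiSplit (↥(maximalRealSubfield L)) L (IsCMField.complexConj L) 3).Adelic).subtype)).subRep E hE).IsIrreducible →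
          FiniteDimensional ℂ (Representation.homRangeSum ((resGMidBlock L μ ξ μω).toContRep.restrict (((standardMaximalCompactGL 3 L).comap (adelicVal (↥(maximalRealSubfield L)) L (IsCMField.complexConj L) 3 ((StdForm.antidiagonal 3).over L)) : Subgroup (quasiSplit (↥(maximalRealSubfield L)) L (IsCMField.complexConj L) 3).Adelic).subtype)).toRepresentation (((resGMidBlock L μ ξ μω).toContRep.restrict (((standardMaximalCompactGL 3 L).comap (adelicVal (↥(maximalRealSubfield L)) L (IsCMField.complexConj L) 3 ((StdForm.antidiagonal 3).over L)) : Subgroup (quasiSplit (↥(maximalRealSubfield L)) L (IsCMField.complexConj L) 3).Adelic).subtype)).subRep E hE)) :=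
  hDISC_of_tauRecord hW1 fun L _ _ _ μ _ μω hμu ξ => hTRANSτ_of_exports_of_arch L μ ξ μω hμu (hEXI L μ μω hμu ξ) (hARCH L μ μω hμu ξ)

end Summit.HodgeConjecture.HodgeConjecture.R90.S8

end
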